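import Mathlib

/-!
# The smooth vectors of a strongly continuous representation of a profinite group are dense

Kernel form of one sentence of the cell's Tier-5 record (route/T5-N4-p5.md v12, (A3) STEP 3 (γ)):
«`⋃_{K_f} L^{K_f}` is dense in `L` (for `f ∈ L` the `K_f`-average `e_{K_f} f` satisfies
`‖e_{K_f} f − f‖ ≤ sup_{k ∈ K_f} ‖R(k) f − f‖ → 0` as `K_f` shrinks, by the continuity of `R`)».

Setting: `K` a compact totally disconnected (profinite) group, `E` a complex Banach space,
`ρ : K →* (E →L[ℂ] E)` a representation which is strongly continuous (`k ↦ ρ k v` is continuous for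
every `v`).  A vector is SMOOTH if it is fixed by some open subgroup of `K`.

* `exists_openSubgroup_subset_of_mem_nhds'` — in a profinite group every neighbourhood of `1`
  contains an open subgroup (Mathlib's `ProfiniteGrp.exist_openNormalSubgroup_sub_open_nhds_of_one`;
  the same three-line lemma as `T5KFiniteOpenStabilizer.exists_openSubgroup_subset_of_mem_nhds`,
  repeated here so that this file imports Mathlib only).
* `exists_openSubgroup_forall_norm_sub_lt` — for every `f` and `ε > 0` some open subgroup `H` moves
  `f` by less than `ε` (the set `{k | ‖ρ k f − f‖ < ε}` is an open neighbourhood of `1`).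
* `apply_setIntegral_orbit` — the `H`-average `∫_H ρ k f dμ` (Bochner integral over the open subgroup
  `H` for a left Haar measure `μ` on `K`) is fixed by `H` (left invariance of `μ`).
* `norm_setAverage_sub_le` — `‖μ(H)⁻¹ ∫_H ρ k f dμ − f‖ ≤ sup_{k ∈ H} ‖ρ k f − f‖`.
* `dense_setOf_exists_openSubgroup_fixed` — **the smooth vectors are dense** (no unitarity is used,
  only strong continuity; the Haar measure is Mathlib's `MeasureTheory.Measure.haar`).

Everything about `L²([U(W_A)])` and the right regular representation stays prose ([C] + [P]); this file
certifies the abstract sentence.  Mathlib only; no definitions.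
-/

namespace Summit.Ventures.HodgeRepro2.T5SmoothVectorsDense

open MeasureTheory Topology

variable {K : Type*} [Group K] [TopologicalSpace K] [IsTopologicalGroup K] [CompactSpace K]
variable {E : Type*} [NormedAddCommGroup E] [NormedSpace ℂ E] [CompleteSpace E]

/-- In a compact totally disconnected group every neighbourhood of `1` contains an open subgroup
(Mathlib's `ProfiniteGrp.exist_openNormalSubgroup_sub_open_nhds_of_one`). -/
theorem exists_openSubgroup_subset_of_mem_nhds' [TotallyDisconnectedSpace K] {U : Set K}
    (hU : U ∈ 𝓝 (1 : K)) : ∃ H : OpenSubgroup K, (H : Set K) ⊆ U := by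
  obtain ⟨V, hVU, hVopen, h1V⟩ := mem_nhds_iff.1 hU
  obtain ⟨H, hH⟩ := ProfiniteGrp.exist_openNormalSubgroup_sub_open_nhds_of_one hVopen h1V
  exact ⟨H.toOpenSubgroup, fun x hx => hVU (hH hx)⟩

omit [CompleteSpace E] in
/-- For every `f` and `ε > 0`, some open subgroup of the profinite group `K` moves `f` by less
than `ε`. -/
theorem exists_openSubgroup_forall_norm_sub_lt [TotallyDisconnectedSpace K]
    (ρ : K →* (E →L[ℂ] E)) (hcont : ∀ v, Continuous fun k => ρ k v) (f : E) {ε : ℝ} (hε : 0 < ε) :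
    ∃ H : OpenSubgroup K, ∀ k ∈ H, ‖ρ k f - f‖ < ε := by
  have hc : Continuous fun k : K => ‖ρ k f - f‖ := ((hcont f).sub continuous_const).norm
  have hopen : IsOpen {k : K | ‖ρ k f - f‖ < ε} := isOpen_lt hc continuous_const
  have hU : {k : K | ‖ρ k f - f‖ < ε} ∈ 𝓝 (1 : K) := by
    refine hopen.mem_nhds ?_
    show ‖ρ 1 f - f‖ < ε
    rw [map_one, one_apply_eq_self, sub_self, norm_zero]
    exact hε
  obtain ⟨H, hH⟩ := exists_openSubgroup_subset_of_mem_nhds' hU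
  exact ⟨H, fun k hk => hH hk⟩

section Haar

variable [T2Space K] [MeasurableSpace K] [BorelSpace K] (μ : Measure K) [μ.IsHaarMeasure]

omit [CompleteSpace E] in
/-- The orbit map `k ↦ ρ k f` is integrable on an open subgroup. -/
theorem integrableOn_orbit (ρ : K →* (E →L[ℂ] E)) (hcont : ∀ v, Continuous fun k => ρ k v)
    (f : E) (H : OpenSubgroup K) : IntegrableOn (fun k => ρ k f) (H : Set K) μ :=
  (hcont f).continuousOn.integrableOn_compact H.isClosed.isCompact

/-- The `H`-average of the orbit of `f` is fixed by `H` (left invariance of the Haar measure). -/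
theorem apply_setIntegral_orbit (ρ : K →* (E →L[ℂ] E))
    (hcont : ∀ v, Continuous fun k => ρ k v) (f : E) (H : OpenSubgroup K) {h : K} (hh : h ∈ H) :
    ρ h (∫ k in (H : Set K), ρ k f ∂μ) = ∫ k in (H : Set K), ρ k f ∂μ := by
  rw [← ContinuousLinearMap.integral_comp_comm _ (integrableOn_orbit μ ρ hcont f H)]
  have hmeas : MeasurableSet (H : Set K) := H.isOpen.measurableSet
  rw [← integral_indicator hmeas, ← integral_indicator hmeas]
  have hpt : ∀ k, (H : Set K).indicator (fun k => ρ h (ρ k f)) k =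
      (H : Set K).indicator (fun k => ρ k f) (h * k) := by
    intro k
    by_cases hk : k ∈ (H : Set K)
    · have hk' : h * k ∈ (H : Set K) := H.mul_mem hh hk
      rw [Set.indicator_of_mem hk, Set.indicator_of_mem hk', map_mul, mul_apply_eq_comp]
    · have hk' : h * k ∉ (H : Set K) := by
        intro hm
        apply hk
        have := H.mul_mem (H.inv_mem hh) hm
        rwa [inv_mul_cancel_left] at this
      rw [Set.indicator_of_notMem hk, Set.indicator_of_notMem hk']
  simp_rw [hpt]
  exact integral_mul_left_eq_self _ h

/-- The normalised `H`-average of the orbit of `f` is within `sup_{k ∈ H} ‖ρ k f − f‖` of `f`. -/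
theorem norm_setAverage_sub_le (ρ : K →* (E →L[ℂ] E)) (hcont : ∀ v, Continuous fun k => ρ k v)
    (f : E) (H : OpenSubgroup K) {C : ℝ} (hC : ∀ k ∈ H, ‖ρ k f - f‖ ≤ C) :
    ‖(μ.real (H : Set K))⁻¹ • ∫ k in (H : Set K), ρ k f ∂μ - f‖ ≤ C := by
  have hpos : 0 < μ.real (H : Set K) :=
    lt_of_le_of_ne measureReal_nonneg
      ((measureReal_ne_zero_iff (measure_ne_top μ _)).2 (H.isOpen.measure_pos μ ⟨1, H.one_mem⟩).ne').symm
  have hf : (μ.real (H : Set K))⁻¹ • ∫ _k in (H : Set K), f ∂μ = f := by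
    rw [setIntegral_const, smul_smul, inv_mul_cancel₀ hpos.ne', one_smul]
  have hsub : (∫ k in (H : Set K), ρ k f ∂μ) - ∫ _k in (H : Set K), f ∂μ =
      ∫ k in (H : Set K), (ρ k f - f) ∂μ := by
    rw [integral_sub (integrableOn_orbit μ ρ hcont f H) (integrableOn_const (by simp))]
  have hbound : ‖∫ k in (H : Set K), (ρ k f - f) ∂μ‖ ≤ C * μ.real (H : Set K) :=
    norm_setIntegral_le_of_norm_le_const (measure_lt_top μ _) fun k hk => hC k hk
  calc ‖(μ.real (H : Set K))⁻¹ • ∫ k in (H : Set K), ρ k f ∂μ - f‖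
      = ‖(μ.real (H : Set K))⁻¹ • ((∫ k in (H : Set K), ρ k f ∂μ) -
          ∫ _k in (H : Set K), f ∂μ)‖ := by rw [smul_sub, hf]
    _ = (μ.real (H : Set K))⁻¹ * ‖∫ k in (H : Set K), (ρ k f - f) ∂μ‖ := by
        rw [hsub, norm_smul, Real.norm_eq_abs, abs_of_pos (inv_pos.2 hpos)]
    _ ≤ (μ.real (H : Set K))⁻¹ * (C * μ.real (H : Set K)) := by
        apply mul_le_mul_of_nonneg_left hbound (inv_pos.2 hpos).le
    _ = C := by field_simp

/-- The normalised `H`-average of the orbit of `f` is fixed by `H`. -/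
theorem apply_average (ρ : K →* (E →L[ℂ] E)) (hcont : ∀ v, Continuous fun k => ρ k v)
    (f : E) (H : OpenSubgroup K) {h : K} (hh : h ∈ H) :
    ρ h ((μ.real (H : Set K))⁻¹ • ∫ k in (H : Set K), ρ k f ∂μ) =
      (μ.real (H : Set K))⁻¹ • ∫ k in (H : Set K), ρ k f ∂μ := by
  rw [ContinuousLinearMap.map_smul_of_tower, apply_setIntegral_orbit μ ρ hcont f H hh]

end Haar

/-- **The smooth vectors are dense**: for a strongly continuous representation `ρ` of a profinite
group `K` on a complex Banach space `E`, the vectors fixed by some open subgroup of `K` form a dense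
subset of `E`. -/
theorem dense_setOf_exists_openSubgroup_fixed [TotallyDisconnectedSpace K] [T2Space K]
    (ρ : K →* (E →L[ℂ] E))
    (hcont : ∀ v, Continuous fun k => ρ k v) :
    Dense {f : E | ∃ H : OpenSubgroup K, ∀ k ∈ H, ρ k f = f} := by
  borelize K
  let μ : Measure K := Measure.haar
  rw [Metric.dense_iff]
  intro f r hr
  obtain ⟨H, hH⟩ := exists_openSubgroup_forall_norm_sub_lt ρ hcont f (half_pos hr)
  refine ⟨(μ.real (H : Set K))⁻¹ • ∫ k in (H : Set K), ρ k f ∂μ, ?_, H, fun h hh => ?_⟩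
  · rw [Metric.mem_ball, dist_eq_norm]
    exact lt_of_le_of_lt (norm_setAverage_sub_le μ ρ hcont f H fun k hk => (hH k hk).le)
      (half_lt_self hr)
  · exact apply_average μ ρ hcont f H hh


/-! ### Appendix (v2, append-only): the `H`-average as the level projection `e_H`

The operator `e_H f := μ(H)⁻¹ ∫_H ρ k f dμ` of (A3) STEP 3 (γ) / (A4)(2) («averaging with `e_{K′_f}`
(continuous)»): linear, contracting for an isometric `ρ`, idempotent, with range the `H`-fixed vectors
and `e_H f = f ⟺ f` is `H`-fixed.  The declarations above are unchanged. -/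

section LevelProjection

variable [T2Space K] [MeasurableSpace K] [BorelSpace K] (μ : Measure K) [μ.IsHaarMeasure]

omit [CompleteSpace E] in
/-- `e_H` is additive. -/
theorem average_add (ρ : K →* (E →L[ℂ] E)) (hcont : ∀ v, Continuous fun k => ρ k v)
    (H : OpenSubgroup K) (f g : E) :
    (μ.real (H : Set K))⁻¹ • ∫ k in (H : Set K), ρ k (f + g) ∂μ =
      (μ.real (H : Set K))⁻¹ • ∫ k in (H : Set K), ρ k f ∂μ +
        (μ.real (H : Set K))⁻¹ • ∫ k in (H : Set K), ρ k g ∂μ := by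
  simp_rw [map_add]
  rw [integral_add (integrableOn_orbit μ ρ hcont f H) (integrableOn_orbit μ ρ hcont g H), smul_add]

omit [CompleteSpace E] in
/-- `e_H` commutes with subtraction. -/
theorem average_sub (ρ : K →* (E →L[ℂ] E)) (hcont : ∀ v, Continuous fun k => ρ k v)
    (H : OpenSubgroup K) (f g : E) :
    (μ.real (H : Set K))⁻¹ • ∫ k in (H : Set K), ρ k (f - g) ∂μ =
      (μ.real (H : Set K))⁻¹ • ∫ k in (H : Set K), ρ k f ∂μ -
        (μ.real (H : Set K))⁻¹ • ∫ k in (H : Set K), ρ k g ∂μ := by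
  simp_rw [map_sub]
  rw [integral_sub (integrableOn_orbit μ ρ hcont f H) (integrableOn_orbit μ ρ hcont g H), smul_sub]

omit [IsTopologicalGroup K] [CompactSpace K] [CompleteSpace E] [T2Space K] [BorelSpace K]
  [μ.IsHaarMeasure] in
/-- `e_H` is `ℂ`-homogeneous. -/
theorem average_smul (ρ : K →* (E →L[ℂ] E)) (H : OpenSubgroup K) (c : ℂ) (f : E) :
    (μ.real (H : Set K))⁻¹ • ∫ k in (H : Set K), ρ k (c • f) ∂μ =
      c • (μ.real (H : Set K))⁻¹ • ∫ k in (H : Set K), ρ k f ∂μ := by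
  simp_rw [map_smul]
  rw [integral_smul, smul_comm]

omit [IsTopologicalGroup K] [T2Space K] in
/-- `e_H f = f` for an `H`-fixed vector `f`. -/
theorem average_eq_self_of_forall_apply_eq (ρ : K →* (E →L[ℂ] E)) (H : OpenSubgroup K) {f : E}
    (hf : ∀ k ∈ H, ρ k f = f) :
    (μ.real (H : Set K))⁻¹ • ∫ k in (H : Set K), ρ k f ∂μ = f := by
  have hpos : 0 < μ.real (H : Set K) :=
    lt_of_le_of_ne measureReal_nonneg
      ((measureReal_ne_zero_iff (measure_ne_top μ _)).2 (H.isOpen.measure_pos μ ⟨1, H.one_mem⟩).ne').symm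
  have hint : ∫ k in (H : Set K), ρ k f ∂μ = ∫ _k in (H : Set K), f ∂μ :=
    setIntegral_congr_fun H.isOpen.measurableSet fun k hk => hf k hk
  rw [hint, setIntegral_const, smul_smul, inv_mul_cancel₀ hpos.ne', one_smul]

/-- `e_H f = f` if and only if `f` is `H`-fixed. -/
theorem average_eq_self_iff (ρ : K →* (E →L[ℂ] E)) (hcont : ∀ v, Continuous fun k => ρ k v)
    (H : OpenSubgroup K) (f : E) :
    (μ.real (H : Set K))⁻¹ • ∫ k in (H : Set K), ρ k f ∂μ = f ↔ ∀ k ∈ H, ρ k f = f := by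
  constructor
  · intro h k hk
    have := apply_average μ ρ hcont f H hk
    rwa [h] at this
  · exact average_eq_self_of_forall_apply_eq μ ρ H

/-- `e_H` is idempotent. -/
theorem average_average (ρ : K →* (E →L[ℂ] E)) (hcont : ∀ v, Continuous fun k => ρ k v)
    (H : OpenSubgroup K) (f : E) :
    (μ.real (H : Set K))⁻¹ • ∫ k in (H : Set K),
        ρ k ((μ.real (H : Set K))⁻¹ • ∫ k' in (H : Set K), ρ k' f ∂μ) ∂μ =
      (μ.real (H : Set K))⁻¹ • ∫ k in (H : Set K), ρ k f ∂μ :=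
  average_eq_self_of_forall_apply_eq μ ρ H fun _ hh => apply_average μ ρ hcont f H hh

omit [IsTopologicalGroup K] [CompleteSpace E] [T2Space K] [BorelSpace K] in
/-- For an isometric (more generally, contracting) `ρ`, `e_H` is contracting: `‖e_H f‖ ≤ ‖f‖`. -/
theorem norm_average_le (ρ : K →* (E →L[ℂ] E)) (hiso : ∀ k v, ‖ρ k v‖ ≤ ‖v‖)
    (H : OpenSubgroup K) (f : E) :
    ‖(μ.real (H : Set K))⁻¹ • ∫ k in (H : Set K), ρ k f ∂μ‖ ≤ ‖f‖ := by
  have hpos : 0 < μ.real (H : Set K) :=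
    lt_of_le_of_ne measureReal_nonneg
      ((measureReal_ne_zero_iff (measure_ne_top μ _)).2 (H.isOpen.measure_pos μ ⟨1, H.one_mem⟩).ne').symm
  have hbound : ‖∫ k in (H : Set K), ρ k f ∂μ‖ ≤ ‖f‖ * μ.real (H : Set K) :=
    norm_setIntegral_le_of_norm_le_const (measure_lt_top μ _) fun k _ => hiso k f
  rw [norm_smul, Real.norm_eq_abs, abs_of_pos (inv_pos.2 hpos)]
  calc (μ.real (H : Set K))⁻¹ * ‖∫ k in (H : Set K), ρ k f ∂μ‖
      ≤ (μ.real (H : Set K))⁻¹ * (‖f‖ * μ.real (H : Set K)) :=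
        mul_le_mul_of_nonneg_left hbound (inv_pos.2 hpos).le
    _ = ‖f‖ := by field_simp

omit [CompleteSpace E] in
/-- For an isometric `ρ`, `e_H` is `1`-Lipschitz, in particular continuous. -/
theorem lipschitzWith_average (ρ : K →* (E →L[ℂ] E)) (hcont : ∀ v, Continuous fun k => ρ k v)
    (hiso : ∀ k v, ‖ρ k v‖ ≤ ‖v‖) (H : OpenSubgroup K) :
    LipschitzWith 1 fun f : E => (μ.real (H : Set K))⁻¹ • ∫ k in (H : Set K), ρ k f ∂μ := by
  refine LipschitzWith.of_dist_le_mul fun f g => ?_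
  rw [dist_eq_norm, dist_eq_norm, ← average_sub μ ρ hcont H f g]
  simpa using norm_average_le μ ρ hiso H (f - g)

omit [CompleteSpace E] in
/-- `e_H` is continuous (isometric `ρ`). -/
theorem continuous_average (ρ : K →* (E →L[ℂ] E)) (hcont : ∀ v, Continuous fun k => ρ k v)
    (hiso : ∀ k v, ‖ρ k v‖ ≤ ‖v‖) (H : OpenSubgroup K) :
    Continuous fun f : E => (μ.real (H : Set K))⁻¹ • ∫ k in (H : Set K), ρ k f ∂μ :=
  (lipschitzWith_average μ ρ hcont hiso H).continuous

end LevelProjection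

end Summit.Ventures.HodgeRepro2.T5SmoothVectorsDense
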